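import Literature.NumberTheory.Automorphic.GLnIntegralLeviUnipotent
import Literature.MeasureTheory.Group.InvariantQuotientCompactOpenMass
import HarnessLib

/-!
# The Iwasawa constant of the canonical quotient measure on `GL_n(F) ⧸ M_c` is pinned by the `K`-masses, and is `1` at the
# volume-one normalisations
(Rogawski (1990), §4.13, Lemma 4.13.1 p. 64 and its proof pp. 64–66 «the quotient measure on `G ⧸ M` … `G = KP`, `P = MU`», with the
normalisations of §4.4 p. 44 and the compatible measures of §4.3 (4.3.1) p. 43; Deitmar–Echterhoff (2014), Thm. 1.5.3; Gelbart
(1975), Thm. 9.22 (iii))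

Topic `NumberTheory/Automorphic`; namespace `Literature.NumberTheory.Automorphic`. KERNEL mathematics only: theorems, no definition,
no named fact, no instance, no `sorry`. Cell `pub/hodgecm-mathlib`, programme P3a, roads «D-N6s» ∕ «D-N7s», brick «D-S1c-one» part (I)
(LEAD F0P3a-plan T7-7 (B)(d3), T7-8, T7-17 (B)). ★ `exists_quotientMeasure_levi_eq_smul_map` (`GLnLeviQuotientIwasawaIntegration`)
writes every invariant Radon measure on `GL_n(F) ⧸ M_c` as `C • π_*(κ ⊗ μ_U)`, `π(k, u) = k u M_c`, with an unspecified `C ≠ 0`. For the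
CANONICAL quotient measure `ν∕ν_A` (★ `quotientMeasure`, Weil's formula with constant one) the constant is determined by evaluating both
sides on the open set `K M_c ∕ M_c`, `K = GL_n(𝒪)`:

* `mk_mul_mem_image_glInt_iff` — for `k ∈ K`, `u ∈ U_c`: `(k u) M_c ∈ π(K) ↔ u ∈ K` (via `u m ∈ K ↔ u ∈ K ∧ m ∈ K`, from ★
  `levi_mul_unipotent_mem_glInt_iff`); `prod_preimage_image_glInt_eq` — `(κ ⊗ μ_U)(π⁻¹(K M_c∕M_c)) = κ(K) · μ_U(U_c ∩ K)`.
* **`coe_mul_measure_eq_of_quotientMeasure_eq_smul_map`** — if `ν∕ν_A = C • π_*(κ ⊗ μ_U)` then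
  `C · κ(K) μ_U(U_c ∩ K) · ν_A(A ∩ K) = ν(K)` (★ `quotientMeasure_image_mk_mul_eq`: `(ν∕ν_A)(K A∕A) · ν_A(A ∩ K) = ν(K)`).
* **`eq_one_of_quotientMeasure_eq_smul_map`** — hence `C = 1` at the four volume-one normalisations
  `ν(K) = ν_A(A ∩ K) = κ(K) = μ_U(U_c ∩ K) = 1` (Rogawski's «`dg = dk dm du`» with his normalisations).

The hypothesis style `{C} (hq : quotientMeasure A νA _ ν = C • Measure.map π (κ.prod μN))` is the one of ★ C2b §1
(`integral_descConj_eq_smul_integral_prod`). See also ★ `GLnLeviQuotientIwasawaCanonical.quotientMeasure_levi_eq_map` (F0P3a-p04: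
the hypothesis-free identity `ν∕ν_A = π_*(κ ⊗ μ_U)` at the normalisations, obtained from ★ C2b's `∃ C`) — the statements here are the
`hq`-forms for a GIVEN `C`; part (II) ★ `GLnLeviOrbitalDescentCanonicalOne` carries the descent identity for every torus `T ≤ M_c` with
this `C` explicit, and with `C = 1`.

## References
* [Rogawski1990] J. D. Rogawski, *Automorphic Representations of Unitary Groups in Three Variables*, Ann. of Math. Stud. 123 (1990),
  §4.13, proof of Lemma 4.13.1, pp. 64–66; §4.4 p. 44; §4.3 (4.3.1) p. 43.
* [DeitmarEchterhoff2014] A. Deitmar, S. Echterhoff, *Principles of Harmonic Analysis*, 2nd ed. (2014), Thm. 1.5.3.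
* [Gelbart1975] S. Gelbart, *Automorphic forms on adele groups*, Ann. of Math. Stud. 83 (1975), Thm. 9.22 (iii), Remark 9.23.
-/

set_option autoImplicit false

noncomputable section

open scoped MatrixGroups NNReal ENNReal
open MeasureTheory Measure Matrix Topology Set

namespace Literature.NumberTheory.Automorphic

open Literature.MeasureTheory.Group
open Literature.NumberTheory.GaloisRepresentations.IsNonarchimedeanLocalField

section Membership

variable {F : Type*} [Field F] [ValuativeRel F] {n : ℕ} {α : Type*} [LinearOrder α] [Fintype α] {c : Fin n → α}

/-- **`u m ∈ GL_n(𝒪) ↔ u ∈ GL_n(𝒪) ∧ m ∈ GL_n(𝒪)`** for `u ∈ U_c`, `m ∈ M_c` (the order `u m`; ★ `levi_mul_unipotent_mem_glInt_iff` is the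
order `m u`): `u m = m (m⁻¹ u m)` with `m⁻¹ u m ∈ U_c` (★ `conj_mem_unipotentRadicalGL_of_mem_standardLeviGL`).
[cite: Rogawski1990, §4.13, proof of Lemma 4.13.1, pp. 64–66] -/
private theorem unipotent_mul_levi_mem_glInt_iff {u m : GL (Fin n) F} (hu : u ∈ unipotentRadicalGL F c)
    (hm : m ∈ standardLeviGL F c) : u * m ∈ glInt n F ↔ u ∈ glInt n F ∧ m ∈ glInt n F := by
  have hconj : m⁻¹ * u * m⁻¹⁻¹ ∈ unipotentRadicalGL F c :=
    conj_mem_unipotentRadicalGL_of_mem_standardLeviGL c (inv_mem hm) hu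
  rw [inv_inv] at hconj
  have hum : u * m = m * (m⁻¹ * u * m) := by group
  rw [hum, levi_mul_unipotent_mem_glInt_iff hm hconj]
  constructor
  · rintro ⟨hmK, hcK⟩
    refine ⟨?_, hmK⟩
    have : u = m * (m⁻¹ * u * m) * m⁻¹ := by group
    rw [this]
    exact mul_mem (mul_mem hmK hcK) (inv_mem hmK)
  · rintro ⟨huK, hmK⟩
    exact ⟨hmK, mul_mem (mul_mem (inv_mem hmK) huK) hmK⟩

/-- **`(k u) A ∈ π(K) ↔ u ∈ K`** for `k ∈ K = GL_n(𝒪)`, `u ∈ U_c` and `A = M_c` (`π : G → G ⧸ A`): if `k u A = k′ A` with `k′ ∈ K` then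
`u m = k⁻¹ k′ ∈ K` for some `m ∈ M_c`, so `u ∈ K` (`unipotent_mul_levi_mem_glInt_iff`). [cite: Rogawski1990, §4.13, proof of Lemma 4.13.1, pp. 64–66] -/
theorem mk_mul_mem_image_glInt_iff {A : Subgroup (GL (Fin n) F)} (hA : A = standardLeviGL F c)
    {k u : GL (Fin n) F} (hk : k ∈ glInt n F) (hu : u ∈ unipotentRadicalGL F c) :
    (QuotientGroup.mk (k * u) : GL (Fin n) F ⧸ A) ∈
        (QuotientGroup.mk '' (glInt n F : Set (GL (Fin n) F)) : Set (GL (Fin n) F ⧸ A)) ↔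
      u ∈ glInt n F := by
  subst hA
  constructor
  · rintro ⟨k', hk', h⟩
    have hm : k'⁻¹ * (k * u) ∈ standardLeviGL F c := QuotientGroup.eq.1 h
    have hprod : u * (k'⁻¹ * (k * u))⁻¹ ∈ glInt n F := by
      have : u * (k'⁻¹ * (k * u))⁻¹ = k⁻¹ * k' := by group
      rw [this]
      exact mul_mem (inv_mem hk) hk'
    exact ((unipotent_mul_levi_mem_glInt_iff hu (inv_mem hm)).1 hprod).1
  · intro huK
    exact ⟨k * u, mul_mem hk huK, rfl⟩

end Membership

section Iwasawa

variable (F : Type*) [Field F] [ValuativeRel F] [TopologicalSpace F] [IsNonarchimedeanLocalField F]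
  {n : ℕ} {α : Type*} [LinearOrder α] [Fintype α] {c : Fin n → α}
  [MeasurableSpace (GL (Fin n) F)] [BorelSpace (GL (Fin n) F)]

omit [TopologicalSpace F] [IsNonarchimedeanLocalField F] [BorelSpace (GL (Fin n) F)] in
/-- **`(κ ⊗ μ_U)(π⁻¹(KA∕A)) = κ(K) · μ_U(U_c ∩ K)`** (`π(k, u) = k u A`): by `mk_mul_mem_image_glInt_iff` the preimage is the box
`K × (U_c ∩ K)`. [cite: Rogawski1990, §4.13, proof of Lemma 4.13.1, pp. 64–66] -/
theorem prod_preimage_image_glInt_eq {A : Subgroup (GL (Fin n) F)} (hA : A = standardLeviGL F c)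
    (κ : Measure ↥(glInt n F)) (μN : Measure ↥(unipotentRadicalGL F c)) [SFinite μN] :
    (κ.prod μN) ((fun p : ↥(glInt n F) × ↥(unipotentRadicalGL F c) =>
        (QuotientGroup.mk ((p.1 : GL (Fin n) F) * (p.2 : GL (Fin n) F)) : GL (Fin n) F ⧸ A)) ⁻¹'
        (QuotientGroup.mk '' (glInt n F : Set (GL (Fin n) F)))) =
      κ univ * μN {u | (u : GL (Fin n) F) ∈ glInt n F} := by
  have hset : (fun p : ↥(glInt n F) × ↥(unipotentRadicalGL F c) =>
        (QuotientGroup.mk ((p.1 : GL (Fin n) F) * (p.2 : GL (Fin n) F)) : GL (Fin n) F ⧸ A)) ⁻¹'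
        (QuotientGroup.mk '' (glInt n F : Set (GL (Fin n) F))) =
      (univ : Set ↥(glInt n F)) ×ˢ {u : ↥(unipotentRadicalGL F c) | (u : GL (Fin n) F) ∈ glInt n F} := by
    ext p
    simp only [Set.mem_preimage, Set.mem_prod, Set.mem_univ, true_and, Set.mem_setOf_eq]
    exact mk_mul_mem_image_glInt_iff hA p.1.2 p.2.2
  rw [hset, Measure.prod_prod]

/-- **The Iwasawa constant of the canonical quotient measure, against the `K`-masses.** Let `A = M_c` (`c` monotone is not needed
here), `ν`, `ν_A` Haar measures on `GL_n(F)` and `A`, `κ`, `μ_U` measures on `K = GL_n(𝒪)` and `U_c`. If the canonical quotient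
measure is `ν∕ν_A = C • π_*(κ ⊗ μ_U)` (★ `exists_quotientMeasure_levi_eq_smul_map`), then
`C · κ(K) · μ_U(U_c ∩ K) · ν_A(A ∩ K) = ν(K)` (evaluate both sides on the open set `KA∕A`: ★ `quotientMeasure_image_mk_mul_eq` and `prod_preimage_image_glInt_eq`).
[cite: Rogawski1990, §4.13, proof of Lemma 4.13.1, pp. 64–66] [cite: DeitmarEchterhoff2014, Thm. 1.5.3] -/
theorem coe_mul_measure_eq_of_quotientMeasure_eq_smul_map
    [T2Space (GL (Fin n) F)] [SecondCountableTopology (GL (Fin n) F)] [LocallyCompactSpace (GL (Fin n) F)]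
    {A : Subgroup (GL (Fin n) F)} (hA : A = standardLeviGL F c) (hAc : IsClosed (A : Set (GL (Fin n) F)))
    [MeasurableSpace (GL (Fin n) F ⧸ A)] [BorelSpace (GL (Fin n) F ⧸ A)]
    (ν : Measure (GL (Fin n) F)) [IsHaarMeasure ν] [ν.IsMulRightInvariant]
    (νA : Measure ↥A) [IsHaarMeasure νA] [νA.IsInvInvariant]
    (κ : Measure ↥(glInt n F)) (μN : Measure ↥(unipotentRadicalGL F c)) [SFinite μN] {C : ℝ≥0}
    (hq : quotientMeasure A νA hAc ν = C • Measure.map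
      (fun p : ↥(glInt n F) × ↥(unipotentRadicalGL F c) =>
        (QuotientGroup.mk ((p.1 : GL (Fin n) F) * (p.2 : GL (Fin n) F)) : GL (Fin n) F ⧸ A)) (κ.prod μN)) :
    (C : ℝ≥0∞) * (κ univ * μN {u | (u : GL (Fin n) F) ∈ glInt n F}) * νA {a : ↥A | (a : GL (Fin n) F) ∈ glInt n F} =
      ν (glInt n F) := by
  haveI : BorelSpace ↥(unipotentRadicalGL F c) := Subtype.borelSpace _
  haveI : BorelSpace ↥(glInt n F) := Subtype.borelSpace _
  haveI : BorelSpace (↥(glInt n F) × ↥(unipotentRadicalGL F c)) := Prod.borelSpace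
  have hπ : Measurable fun p : ↥(glInt n F) × ↥(unipotentRadicalGL F c) =>
      (QuotientGroup.mk ((p.1 : GL (Fin n) F) * (p.2 : GL (Fin n) F)) : GL (Fin n) F ⧸ A) :=
    ((QuotientGroup.continuous_mk (N := A)).comp
      ((continuous_subtype_val.comp continuous_fst).mul (continuous_subtype_val.comp continuous_snd))).measurable
  have himg : MeasurableSet (QuotientGroup.mk '' (glInt n F : Set (GL (Fin n) F)) : Set (GL (Fin n) F ⧸ A)) :=
    (QuotientGroup.isOpenMap_coe _ (isOpen_glInt n F)).measurableSet
  haveI : IsClosed (A : Set (GL (Fin n) F)) := hAc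
  haveI : SFinite νA := inferInstance
  have h := quotientMeasure_image_mk_mul_eq A νA ν (glInt n F) (isOpen_glInt n F)
  rw [hq, Measure.smul_apply, Measure.map_apply hπ himg, prod_preimage_image_glInt_eq F hA κ μN, ENNReal.smul_def,
    smul_eq_mul] at h
  exact h

/-- **At the volume-one normalisations the Iwasawa constant of `ν∕ν_A` is `1`**: if `ν(K) = 1`, `ν_A(A ∩ K) = 1`, `κ(K) = 1`,
`μ_U(U_c ∩ K) = 1` and `ν∕ν_A = C • π_*(κ ⊗ μ_U)`, then `C = 1` (Rogawski's `dg = dk dm du`, §4.4 and proof of Lemma 4.13.1 pp. 64–66).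
[cite: Rogawski1990, §4.13, proof of Lemma 4.13.1, pp. 64–66] [cite: Rogawski1990, §4.4 p. 44] -/
theorem eq_one_of_quotientMeasure_eq_smul_map
    [T2Space (GL (Fin n) F)] [SecondCountableTopology (GL (Fin n) F)] [LocallyCompactSpace (GL (Fin n) F)]
    {A : Subgroup (GL (Fin n) F)} (hA : A = standardLeviGL F c) (hAc : IsClosed (A : Set (GL (Fin n) F)))
    [MeasurableSpace (GL (Fin n) F ⧸ A)] [BorelSpace (GL (Fin n) F ⧸ A)]
    (ν : Measure (GL (Fin n) F)) [IsHaarMeasure ν] [ν.IsMulRightInvariant]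
    (νA : Measure ↥A) [IsHaarMeasure νA] [νA.IsInvInvariant]
    (κ : Measure ↥(glInt n F)) (μN : Measure ↥(unipotentRadicalGL F c)) [SFinite μN] {C : ℝ≥0}
    (hq : quotientMeasure A νA hAc ν = C • Measure.map
      (fun p : ↥(glInt n F) × ↥(unipotentRadicalGL F c) =>
        (QuotientGroup.mk ((p.1 : GL (Fin n) F) * (p.2 : GL (Fin n) F)) : GL (Fin n) F ⧸ A)) (κ.prod μN))
    (hνK : ν (glInt n F) = 1) (hνAK : νA {a : ↥A | (a : GL (Fin n) F) ∈ glInt n F} = 1) (hκ : κ univ = 1)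
    (hμN : μN {u | (u : GL (Fin n) F) ∈ glInt n F} = 1) : C = 1 := by
  have h := coe_mul_measure_eq_of_quotientMeasure_eq_smul_map F hA hAc ν νA κ μN hq
  rw [hνK, hνAK, hκ, hμN, mul_one, mul_one, mul_one] at h
  exact_mod_cast h

end Iwasawa

end Literature.NumberTheory.Automorphic

end
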